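import Summits.AtomisticToContinuum.Crystallization.Theses.ChessboardParticlePlanes
import Summits.AtomisticToContinuum.Crystallization.Theorems.ChessboardParticlePlanesLjBilayerHcpStructuralReduction

/-!
# Strategist sketch (seat cstrat-s1) for crux `ChessboardParticlePlanes.LjBilayerHcp` (stmt-AtomisticToContinuum-6710)

Typed forms of the four census attempts of `STRATEGY-CENSUS.md` (transfer / strengthen / decomposition / negation),
stated over existing declarations, each with the (trivial) logic that connects it to the live open stub
Sσ = `stub_structural` of line `Sketch`.  Nothing here is a new line; the file only certifies that the census
statements elaborate and that the seams are what the census says they are.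
-/

noncomputable section

open scoped BigOperators Classical
open Literature.MathematicalPhysics.StatisticalMechanics

namespace Summit.AtomisticToContinuum.Crystallization.Cruxes.LjBilayerHcp.Strategist

local notation "E3" => EuclideanSpace ℝ (Fin 3)
local notation "E2" => EuclideanSpace ℝ (Fin 2)

/-! ## The live stub Sσ, packaged -/

/-- `B` is a `2/3`-separated NORMAL period-2 stack of spacing `c` (the hypotheses of `stub_structural`). -/
def NormalStack (c : ℝ) (B : PeriodicConfiguration 3) : Prop :=
  (∀ x ∈ B.points, ∀ y ∈ B.points, x ≠ y → (2 : ℝ) / 3 ≤ dist x y) ∧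
  (2 * c) • EuclideanSpace.single (2 : Fin 3) (1 : ℝ) ∈ B.lattice ∧
  (∀ g ∈ B.lattice, ∃ k : ℤ, g 2 = 2 * c * (k : ℝ)) ∧
  (∀ x ∈ B.points, ∃ k : ℤ, x 2 = c * (k : ℝ))

/-- Some hcp OF THE CLASS (`a ≥ 2/3`, `h ≥ 3/4`) has energy per particle `≤ e(B)`. -/
def ClassBeats (B : PeriodicConfiguration 3) : Prop :=
  ∃ a h : ℝ, ∃ (ha : a ≠ 0) (hh : h ≠ 0), 2 / 3 ≤ a ∧ 3 / 4 ≤ h ∧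
    (hcpPeriodicConfiguration ha hh).energyPerParticle lennardJones ≤ B.energyPerParticle lennardJones

/-- Sσ, the open stub of line `Sketch`, in packaged form. -/
def Structural : Prop :=
  ∀ c : ℝ, 3 / 4 ≤ c → ∀ B : PeriodicConfiguration 3, NormalStack c B → ClassBeats B

/-- The packaged form is literally the registered stub signature (so everything below speaks about THE stub). -/
theorem structural_iff :
    Structural ↔
    (∀ c : ℝ, 3 / 4 ≤ c → ∀ B : PeriodicConfiguration 3,
      (∀ x ∈ B.points, ∀ y ∈ B.points, x ≠ y → (2 : ℝ) / 3 ≤ dist x y) →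
      (2 * c) • EuclideanSpace.single (2 : Fin 3) (1 : ℝ) ∈ B.lattice →
      (∀ g ∈ B.lattice, ∃ k : ℤ, g 2 = 2 * c * (k : ℝ)) →
      (∀ x ∈ B.points, ∃ k : ℤ, x 2 = c * (k : ℝ)) →
      ∃ a h : ℝ, ∃ (ha : a ≠ 0) (hh : h ≠ 0), 2 / 3 ≤ a ∧ 3 / 4 ≤ h ∧
        (hcpPeriodicConfiguration ha hh).energyPerParticle lennardJones ≤
          B.energyPerParticle lennardJones) := by
  constructor
  · intro h c hc B h1 h2 h3 h4
    exact h c hc B ⟨h1, h2, h3, h4⟩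
  · intro h c hc B hB
    exact h c hc B hB.1 hB.2.1 hB.2.2.1 hB.2.2.2

/-- Sσ closes the crux (the landed transfer p131363, restated through the package). -/
theorem crux_of_structural (h : Structural) :
    Summit.AtomisticToContinuum.Crystallization.Theses.ChessboardParticlePlanes.LjBilayerHcp :=
  Summit.AtomisticToContinuum.Crystallization.Theorems.LjBilayerHcpSketch.ljBilayerHcp_of_structural
    (structural_iff.mp h)

/-! ## DECOMPOSITION attempt A — regime split in the spacing `c` -/

/-- Sσ restricted to spacings in a set `I`. -/
def StructuralOn (I : Set ℝ) : Prop :=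
  ∀ c ∈ I, 3 / 4 ≤ c → ∀ B : PeriodicConfiguration 3, NormalStack c B → ClassBeats B

/-- The seam of the regime split is one `le_total`: core window `[3/4, c₁]` + far regime `[c₁, ∞)` give Sσ.
Census verdict: the far piece (c₁ = 41/50) is an XL certified-numerics programme of KNOWN type (two-point rod
certificates with margin ≥ 1.4e-2, or cruder bounds beyond c ≈ 1.1); the core piece contains c* = 0.7929 and is the
whole crux. -/
theorem structural_of_regimes (c₁ : ℝ) (hcore : StructuralOn (Set.Iic c₁)) (hfar : StructuralOn (Set.Ici c₁)) :
    Structural := by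
  intro c hc B hB
  rcases le_total c c₁ with h | h
  · exact hcore c h hc B hB
  · exact hfar c h hc B hB

/-! ## DECOMPOSITION attempt B — local / global split at a tube around the hcp family -/

/-- `B` is two-way `ε`-matched, after a linear isometry, with SOME hcp of the class. -/
def NearClassHcp (ε : ℝ) (B : PeriodicConfiguration 3) : Prop :=
  ∃ a h : ℝ, ∃ (ha : a ≠ 0) (hh : h ≠ 0), 2 / 3 ≤ a ∧ 3 / 4 ≤ h ∧
    ∃ A : E3 ≃ₗᵢ[ℝ] E3, ∃ t : E3,
      (∀ x ∈ B.points, ∃ y ∈ (hcpPeriodicConfiguration ha hh).points, dist (A x + t) y ≤ ε) ∧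
      (∀ y ∈ (hcpPeriodicConfiguration ha hh).points, ∃ x ∈ B.points, dist (A x + t) y ≤ ε)

/-- LOCAL piece: inside the `ε`-tube the class-hcp family is optimal (second variation / Bloch positivity of the
two-rod cell over the whole Brillouin zone + anharmonic remainder; certified numerics, size L). -/
def LocalPiece (ε : ℝ) : Prop :=
  ∀ c : ℝ, 3 / 4 ≤ c → ∀ B : PeriodicConfiguration 3, NormalStack c B → NearClassHcp ε B → ClassBeats B

/-- GLOBAL piece: outside the tube.  This is where every known technique class must work anyway (census, two-point
bounds with slack); it is the crux with its equality case removed — still the open two-species planar problem. -/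
def GlobalPiece (ε : ℝ) : Prop :=
  ∀ c : ℝ, 3 / 4 ≤ c → ∀ B : PeriodicConfiguration 3, NormalStack c B → ¬ NearClassHcp ε B → ClassBeats B

/-- Seam of split B: excluded middle on tube membership. -/
theorem structural_of_local_global (ε : ℝ) (hloc : LocalPiece ε) (hglob : GlobalPiece ε) : Structural := by
  intro c hc B hB
  by_cases hnear : NearClassHcp ε B
  · exact hloc c hc B hB hnear
  · exact hglob c hc B hB hnear

/-! ## STRENGTHEN attempt — fixed-spacing optimality S⁺ (the `c`-minimisation removed) -/

/-- S⁺: at EVERY spacing `c ≥ 3/4` the class-hcp OF THAT SPACING (`h = c`, some `a ≥ 2/3`) already beats `B`.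
Numerically true (lead cycle 4 §3: tri-hollow bilayer optimal among lattice bilayers at every c) but it LOSES the
wall margin: at c = 3/4 the square bilayer sits only 1.7e-3 above hcp(a_opt(3/4), 3/4) whereas it sits 2.0e-2 above the
global e*; so S⁺ is harder to certify than Sσ exactly where Sσ has its only comfortable slack. -/
def FixedSpacing : Prop :=
  ∀ c : ℝ, 3 / 4 ≤ c → ∀ B : PeriodicConfiguration 3, NormalStack c B →
    ∃ a : ℝ, ∃ (ha : a ≠ 0) (hc : c ≠ 0), 2 / 3 ≤ a ∧
      (hcpPeriodicConfiguration ha hc).energyPerParticle lennardJones ≤ B.energyPerParticle lennardJones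

theorem structural_of_fixedSpacing (h : FixedSpacing) : Structural := by
  intro c hc B hB
  obtain ⟨a, ha, hc0, ha23, hle⟩ := h c hc B hB
  exact ⟨a, c, ha, hc0, ha23, hc, hle⟩

/-! ## TRANSFER attempt — the two-point (Bochner) certificate in the rod picture, with the window made explicit -/

/-- Block positive-definiteness of a kernel pair `(g₀, g₁)` on two-coloured finite planar point sets
(configuration-space form; no Fourier analysis needed to STATE it). -/
def BlockPosDef (g₀ g₁ : E2 → ℝ) : Prop :=
  ∀ (n : ℕ) (x : Fin n → E2) (col : Fin n → Bool) (w : Fin n → ℝ),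
    0 ≤ ∑ i, ∑ j, w i * w j * (if col i = col j then g₀ (x i - x j) else g₁ (x i - x j))

/-- Like-rod kernel `K₀(z) = Σ_k V(√(‖z‖² + (2kc)²))` and unlike-rod kernel `K₁(z) = Σ_k V(√(‖z‖² + ((2k+1)c)²))`. -/
def rodKernelEven (c : ℝ) (z : E2) : ℝ := ∑' k : ℤ, lennardJones (Real.sqrt (‖z‖ ^ 2 + (2 * c * k) ^ 2))
def rodKernelOdd (c : ℝ) (z : E2) : ℝ := ∑' k : ℤ, lennardJones (Real.sqrt (‖z‖ ^ 2 + ((2 * k + 1) * c) ^ 2))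
/-- Self-rod energy `S(c) = Σ_{k ≠ 0} V(2|k|c)`. -/
def selfRod (c : ℝ) : ℝ := ∑' k : ℤ, if k = 0 then 0 else lennardJones (|2 * c * k|)

/-- A slab pair of value `e` at spacing `c`: block-PD, minorising the rod kernels (like kernel only beyond the core
`2/3`), with `e ≤ (S(c) − g₀ 0)/2`. -/
def SlabPairAt (c e : ℝ) : Prop :=
  ∃ g₀ g₁ : E2 → ℝ, BlockPosDef g₀ g₁ ∧
    (∀ z : E2, (2 : ℝ) / 3 ≤ ‖z‖ → g₀ z ≤ rodKernelEven c z) ∧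
    (∀ z : E2, g₁ z ≤ rodKernelOdd c z) ∧
    e ≤ (selfRod c - g₀ 0) / 2

/-- R2, the periodic Bochner transfer (rod identity + finite blocks + o(block) boundary): a slab pair of value `e`
at spacing `c` bounds every normal period-2 stack of spacing `c` from below by `e`.  Genuine, M/L-sized, line-independent. -/
def BochnerTransfer : Prop :=
  ∀ c e : ℝ, 3 / 4 ≤ c → SlabPairAt c e → ∀ B : PeriodicConfiguration 3, NormalStack c B →
    e ≤ B.energyPerParticle lennardJones

/-- Far-regime certificates: for every `c ≥ c₁` a slab pair whose value reaches the energy of SOME class-hcp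
(then that hcp beats `B`).  XL certified numerics; numerically the relaxed (phantom) optimum clears e* by
+1.4e-2 at c = 0.82 and +3.2e-2 at 0.85 (lead cycle 4 §2), so pairs with margin exist there. -/
def FarCertificates (c₁ : ℝ) : Prop :=
  ∀ c : ℝ, c₁ ≤ c → 3 / 4 ≤ c →
    ∃ a h : ℝ, ∃ (ha : a ≠ 0) (hh : h ≠ 0), 2 / 3 ≤ a ∧ 3 / 4 ≤ h ∧
      SlabPairAt c ((hcpPeriodicConfiguration ha hh).energyPerParticle lennardJones)

/-- The transfer closes exactly the FAR piece of split A — and nothing in the core window, where a pair of value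
e* at c* would have to be SHARP (a two-coloured A₂ "magic pair": open even for one species and Gaussian potentials). -/
theorem far_of_transfer (c₁ : ℝ) (hT : BochnerTransfer) (hF : FarCertificates c₁) : StructuralOn (Set.Ici c₁) := by
  intro c hc1 hc B hB
  obtain ⟨a, h, ha, hh, ha23, hh34, hpair⟩ := hF c hc1 hc
  exact ⟨a, h, ha, hh, ha23, hh34, hT c _ hc hpair B hB⟩

/-! ## NEGATION attempt — what a counterexample would have to be -/

/-- The negation of Sσ, typed: a spacing `c ≥ 3/4` and a normal stack that EVERY class-hcp fails to beat. Four
numerical campaigns (lead cycles 1–4) and this seat's direct probe (kit j024508 + j024725, FK / square–triangle seeds + cells up to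
16+16 rods) found no candidate; the nearest feasible competitor stays +1.7e-3 (square bilayer at the wall vs hcp at
the wall) and +2.0e-2 above e*. -/
theorem not_structural_iff :
    ¬ Structural ↔ ∃ c : ℝ, 3 / 4 ≤ c ∧ ∃ B : PeriodicConfiguration 3, NormalStack c B ∧ ¬ ClassBeats B := by
  simp only [Structural, not_forall, exists_prop]

end Summit.AtomisticToContinuum.Crystallization.Cruxes.LjBilayerHcp.Strategist

end
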